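import Summits.BirchSwinnertonDyer.Rank1Residual.Additive.DeuringThree
import Summits.BirchSwinnertonDyer.Rank1Residual.Additive.TypeGThreeUnitJ
import HarnessLib

/-!
# (G)-ordinary at `p = 3` ⟺ additive with `j` a `3`-adic unit ⟺ potentially good ORDINARY (somewhere ⟺ everywhere)

HONEST FRAMING (cell `b2b-bsdres`, run/shared/lean/b2b/bsd-rank1-residual/, verbatim in every
file): the goal of the cell is to DELETE the COMBINATION-SHAPED residual classes of the
Birch–Swinnerton-Dyer formula for ALL analytic-rank `≤ 1` elliptic curves over `ℚ` — "full BSD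
formula for every rank `≤ 1` curve in class `C`" assembled STRICTLY from published theorems — so
that the rank-`≤ 1` remainder becomes exactly the CONSTRUCTION-SHAPED classes, which are TYPED
(missing-input `Prop`s), NOT attempted. This is not "finishing BSD". Sub-cell `additive-p2`
(X3♯(G-ord)/X4♯(G-ord): additive `p`, potentially good ORDINARY), generation 10: research route;
no claim beyond the stated classes; theorems only, no definition, no named fact;
X3♯(G-ord)/X4♯(G-ord) stay CONSTRUCTION-SHAPED; labels / census / located gap UNCHANGED.

WHAT THIS FILE DOES. Gen 9 proved "(G)-ordinary = potentially good ordinary" at every `p ≥ 5`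
(`typeGOrd_iff_exists_good_unitRoot`, `TypeGOrd.hasUnitRootAt_baseChange`) and left the `p = 3`
twin as NEXT (a). Here it is, in a SHARPER, datum-free form special to `p = 3` (where `j = 0` is
the only supersingular invariant): for `E/ℚ` with globally minimal model `W`, ADDITIVE at `3`,

* **`typeGOrd_three_iff_padicValRat_j`** — `TypeGOrd W 3 ↔ (j(E) ≠ 0 ∧ ord₃ j(E) = 0)`:
  Delbourgo's standing hypothesis at `p = 3` ("(G) with potential good ordinary reduction") is
  EXACTLY "`j(E)` is a `3`-adic unit" on the additive locus. (⇐: Tate's algorithm at `3`,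
  `typeG_three_of_padicValRat_j_eq_zero`, then Deuring in characteristic `3`; ⇒: over the
  (G)-field the reduction is ordinary, so `j̃ ≠ 0`, so `j` is a unit — `DeuringThree.lean`.)
* **`typeGOrd_three_iff_exists_good_unitRoot`** — `TypeGOrd W 3 ↔` for SOME number field `F` and
  SOME place `w ∋ 3`, `E_F` is good with the unit-root condition at `w` (the census's name
  "additive, potentially good ordinary at `3`" is the theory class verbatim, as at `p ≥ 5`);
* **`TypeGOrd.hasUnitRootAt_baseChange_three`** — a (G)-ordinary pair at `3` is ORDINARY at EVERY
  place of good reduction above `3` of EVERY number field; `typeGOrd_three_iff_typeG_and_forall`;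
* `not_typeGOrd_iff_of_typeG_three` — among (G) pairs at `3` the non-ordinary ones are exactly
  those with `3 ∣ j` (potentially good SUPERSINGULAR);
* class level: `classX3Gord_three_iff_j`, `classX4Gord_three_iff_j` — X3♯(G-ord)/X4♯(G-ord) at
  `p = 3` = X3/X4 ∩ {`j` a `3`-adic unit}: the 421 census pairs at `p = 3` (all of defect `2`,
  `TypeGThree.lean`) are the additive X3/X4 pairs with `3 ∤ num(j)·den(j)`, no twist datum.

References: M. Deuring (1941); J.-P. Serre, J. Tate, *Good reduction of abelian varieties*,
Ann. Math. 88 (1968) §2; D. Delbourgo, Compositio Math. 113 (1998) §1.5, Thm 3, Prop 4;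
J. H. Silverman, *AEC* V.4.1, VII.5.5, *ATAEC* IV.9 Ex. 4.49; A. Kraus, Manuscripta Math. 69
(1990).
-/

noncomputable section

open scoped Classical NumberField

open WeierstrassCurve IsDedekindDomain IsDedekindDomain.HeightOneSpectrum NumberField
  Rat.HeightOneSpectrum Literature.NumberTheory.EllipticCurves
  Literature.NumberTheory.EllipticCurves.Rank1Residual

namespace Summit.BirchSwinnertonDyer.Rank1Residual.Additive

/-! ### `ord₃ j = 0` read at a place above `3` of a number field -/

section Valuation

variable (W : WeierstrassCurve ℚ) [W.IsElliptic] {F : Type*} [Field F] [NumberField F]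
  (w : HeightOneSpectrum (𝓞 F))

/-- At a place `w ∋ 3`: if `j ≠ 0` and `ord₃ j = 0` then `w(j) = 1` (`w(x) = v₃(x)^{e(w|3)}`,
Mathlib `valuation_liesOver`), in particular `¬ w(j) < 1`. [folklore] -/
theorem not_valuation_j_lt_one_of_padicValRat_eq_zero (hw : ((3 : ℕ) : 𝓞 F) ∈ w.asIdeal)
    (hj0 : W.j ≠ 0) (hj : padicValRat 3 W.j = 0) :
    ¬ w.valuation F (algebraMap ℚ F W.j) < 1 := by
  set v : HeightOneSpectrum ℤ := (Rat.HeightOneSpectrum.primesEquiv (R := ℤ)).symm ⟨3, Nat.prime_three⟩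
    with hvdef
  have hv : Rat.HeightOneSpectrum.natGenerator v = 3 :=
    congrArg Subtype.val
      ((Rat.HeightOneSpectrum.primesEquiv (R := ℤ)).apply_symm_apply ⟨3, Nat.prime_three⟩)
  have hunder : w.asIdeal.under ℤ = v.asIdeal := by
    have hle : v.asIdeal ≤ w.asIdeal.under ℤ := by
      rw [Rat.HeightOneSpectrum.asIdeal_eq_span_natGenerator_int, hv, Ideal.span_le,
        Set.singleton_subset_iff, SetLike.mem_coe, Ideal.under_def, Ideal.mem_comap, map_natCast]
      exact hw
    exact (v.isMaximal.eq_of_le (Ideal.IsPrime.ne_top inferInstance) hle).symm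
  haveI : w.asIdeal.LiesOver v.asIdeal := ⟨hunder.symm⟩
  haveI : Fact (Nat.Prime 3) := ⟨Nat.prime_three⟩
  have hvj : v.valuation ℚ W.j = 1 := by
    rw [Rat.HeightOneSpectrum.valuation_eq_exp_neg_padicValRat v hj0, hv, hj]
    simp
  rw [← valuation_liesOver (K := ℚ) (L := F) v w W.j, hvj, one_pow]
  exact lt_irrefl 1

/-- **Good ORDINARY reduction of `E_F` at a place above `3` forces `j(E)` to be a `3`-adic unit**:
`j ≠ 0` and `ord₃ j = 0` (ordinary ⟹ `j̃ ≠ 0` by Deuring in characteristic `3`, so `¬ w(j) < 1`;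
good ⟹ `ord₃ j ≥ 0`). [folklore] -/
theorem padicValRat_j_eq_zero_of_good_unitRoot_three (hw : ((3 : ℕ) : 𝓞 F) ∈ w.asIdeal)
    (hgood : (W.baseChange F).HasGoodReductionAt w) (hunit : (W.baseChange F).HasUnitRootAt w) :
    W.j ≠ 0 ∧ padicValRat 3 W.j = 0 := by
  haveI : Fact (Nat.Prime 3) := ⟨Nat.prime_three⟩
  haveI : (W.baseChange F).IsElliptic := by rw [baseChange]; infer_instance
  have hjF : (W.baseChange F).j = algebraMap ℚ F W.j := W.map_j (algebraMap ℚ F)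
  have hnlt : ¬ w.valuation F (algebraMap ℚ F W.j) < 1 := by
    rw [← hjF]
    exact (hasUnitRootAt_iff_not_valuation_j_lt_one_of_three_mem (W.baseChange F) w hw hgood).mp
      hunit
  have hnn : 0 ≤ padicValRat 3 W.j :=
    padicValRat_j_nonneg_of_hasGoodReductionAt_baseChange W 3 hw hgood
  have hne : ¬ (W.j = 0 ∨ 0 < padicValRat 3 W.j) := fun h ↦
    hnlt (valuation_algebraMap_lt_one_of_padicValRat_pos 3 w hw h)
  obtain ⟨hj0, hle⟩ := not_or.mp hne
  exact ⟨hj0, le_antisymm (not_lt.mp hle) hnn⟩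

end Valuation

/-! ### The dictionary at `p = 3` -/

section Main

variable (W : WeierstrassCurve ℚ) [W.IsElliptic] [W.IsGloballyMinimal]

/-- **`j` a `3`-adic unit on the additive locus ⟹ (G)-ORDINARY at `3`.** `TypeG W 3` by Tate's
algorithm (`typeG_three_of_padicValRat_j_eq_zero`); over the (G)-field every place above `3` is
good with `w(j) = 1`, hence ORDINARY by Deuring in characteristic `3`
(`hasUnitRootAt_of_not_valuation_j_lt_one_three`). -/
theorem typeGOrd_three_of_padicValRat_j_eq_zero (hadd : Addv W 3) (hj0 : W.j ≠ 0)
    (hj : padicValRat 3 W.j = 0) : TypeGOrd W 3 := by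
  obtain ⟨L, iF, iN, iC, F, hF⟩ := typeG_three_of_padicValRat_j_eq_zero W hadd hj0 hj
  haveI : NumberField F := NumberField.of_module_finite ℚ F
  haveI : (W.baseChange F).IsElliptic := by rw [baseChange]; infer_instance
  refine ⟨L, iF, iN, iC, F, fun w hw ↦ ⟨hF w hw, ?_⟩⟩
  have hjF : (W.baseChange F).j = algebraMap ℚ F W.j := W.map_j (algebraMap ℚ F)
  refine hasUnitRootAt_of_not_valuation_j_lt_one_three (W.baseChange F) w hw (hF w hw) ?_
  rw [hjF]
  exact not_valuation_j_lt_one_of_padicValRat_eq_zero W w hw hj0 hj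

omit [W.IsGloballyMinimal] in
/-- **(G)-ORDINARY at `3` ⟹ `j` is a `3`-adic unit** (no additivity needed): over the (G)-field
some place above `3` is good ordinary (`padicValRat_j_eq_zero_of_good_unitRoot_three`). -/
theorem padicValRat_j_eq_zero_of_typeGOrd_three (hG : TypeGOrd W 3) :
    W.j ≠ 0 ∧ padicValRat 3 W.j = 0 := by
  obtain ⟨L, iF, iN, iC, F, hF⟩ := hG
  haveI : NumberField F := NumberField.of_module_finite ℚ F
  haveI : Fact (Nat.Prime 3) := ⟨Nat.prime_three⟩
  obtain ⟨w, hw⟩ := exists_heightOneSpectrum_natCast_mem F 3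
  exact padicValRat_j_eq_zero_of_good_unitRoot_three W w hw (hF w hw).1 (hF w hw).2

/-- **THE DICTIONARY AT `p = 3`, datum-free: (G)-ordinary ⟺ `j` is a `3`-adic unit.** For `E`
additive at `3` (globally minimal `W`): `TypeGOrd W 3 ↔ (j(E) ≠ 0 ∧ ord₃ j(E) = 0)`. Delbourgo's
standing hypothesis "(G) with potential good ORDINARY reduction at `3`" (Compositio 113, Thm 3 /
Prop 4 / Main Conjecture) is read off the `j`-invariant alone; the census cell X3♯(G-ord) ∪
X4♯(G-ord) at `p = 3` (421 pairs, all Kodaira `I₀*`) is {additive at `3`, `3 ∤ j`}. -/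
theorem typeGOrd_three_iff_padicValRat_j (hadd : Addv W 3) :
    TypeGOrd W 3 ↔ W.j ≠ 0 ∧ padicValRat 3 W.j = 0 :=
  ⟨padicValRat_j_eq_zero_of_typeGOrd_three W,
    fun h ↦ typeGOrd_three_of_padicValRat_j_eq_zero W hadd h.1 h.2⟩

/-- **(G)-ORDINARY ⟺ POTENTIALLY GOOD ORDINARY at `p = 3`** (the `p = 3` twin of gen 9's
`typeGOrd_iff_exists_good_unitRoot`): for `E` additive at `3`, `TypeGOrd W 3` iff for SOME number
field `F` and SOME place `w ∋ 3` the base change `E_F` is good with the unit-root condition at `w`. -/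
theorem typeGOrd_three_iff_exists_good_unitRoot (hadd : Addv W 3) :
    TypeGOrd W 3 ↔ ∃ (F : Type) (_ : Field F) (_ : NumberField F) (w : HeightOneSpectrum (𝓞 F)),
      ((3 : ℕ) : 𝓞 F) ∈ w.asIdeal ∧ (W.baseChange F).HasGoodReductionAt w ∧
        (W.baseChange F).HasUnitRootAt w := by
  haveI : Fact (Nat.Prime 3) := ⟨Nat.prime_three⟩
  constructor
  · rintro ⟨L, iF, iN, iC, F, hF⟩
    haveI : NumberField F := NumberField.of_module_finite ℚ F
    obtain ⟨w, hw⟩ := exists_heightOneSpectrum_natCast_mem F 3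
    exact ⟨F, inferInstance, inferInstance, w, hw, hF w hw⟩
  · rintro ⟨F, _, _, w, hw, hgood, hunit⟩
    obtain ⟨hj0, hj⟩ := padicValRat_j_eq_zero_of_good_unitRoot_three W w hw hgood hunit
    exact typeGOrd_three_of_padicValRat_j_eq_zero W hadd hj0 hj

omit [W.IsGloballyMinimal] in
/-- **(G)-ORDINARY at `3` ⟹ ORDINARY EVERYWHERE above `3`**: at EVERY place `w ∋ 3` of EVERY
number field `F` where `E_F` is good, the unit-root condition holds (`j` is a `3`-adic unit, so
`j̃ ≠ 0`, and `j̃ = 0` is the only supersingular invariant in characteristic `3`). The `p = 3`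
twin of gen 9's `TypeGOrd.hasUnitRootAt_baseChange` (no additivity hypothesis needed here). -/
theorem TypeGOrd.hasUnitRootAt_baseChange_three (hG : TypeGOrd W 3) {F : Type*} [Field F]
    [NumberField F] {w : HeightOneSpectrum (𝓞 F)} (hw : ((3 : ℕ) : 𝓞 F) ∈ w.asIdeal)
    (hgood : (W.baseChange F).HasGoodReductionAt w) : (W.baseChange F).HasUnitRootAt w := by
  obtain ⟨hj0, hj⟩ := padicValRat_j_eq_zero_of_typeGOrd_three W hG
  haveI : (W.baseChange F).IsElliptic := by rw [baseChange]; infer_instance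
  have hjF : (W.baseChange F).j = algebraMap ℚ F W.j := W.map_j (algebraMap ℚ F)
  refine hasUnitRootAt_of_not_valuation_j_lt_one_three (W.baseChange F) w hw hgood ?_
  rw [hjF]
  exact not_valuation_j_lt_one_of_padicValRat_eq_zero W w hw hj0 hj

/-- `TypeGOrd W 3 ↔ TypeG W 3 ∧` (ordinary at every good place above `3` of every number field),
for `E` additive at `3`. -/
theorem typeGOrd_three_iff_typeG_and_forall (hadd : Addv W 3) :
    TypeGOrd W 3 ↔ TypeG W 3 ∧ ∀ (F : Type) (_ : Field F) (_ : NumberField F)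
      (w : HeightOneSpectrum (𝓞 F)), ((3 : ℕ) : 𝓞 F) ∈ w.asIdeal →
        (W.baseChange F).HasGoodReductionAt w → (W.baseChange F).HasUnitRootAt w := by
  haveI : Fact (Nat.Prime 3) := ⟨Nat.prime_three⟩
  refine ⟨fun hG ↦ ⟨hG.typeG, fun F _ _ w hw hgood ↦ hG.hasUnitRootAt_baseChange_three W hw hgood⟩,
    fun ⟨hG, hall⟩ ↦ ?_⟩
  obtain ⟨L, iF, iN, iC, F, hF⟩ := hG
  haveI : NumberField F := NumberField.of_module_finite ℚ F
  obtain ⟨w, hw⟩ := exists_heightOneSpectrum_natCast_mem F 3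
  exact (typeGOrd_three_iff_exists_good_unitRoot W hadd).mpr
    ⟨F, inferInstance, inferInstance, w, hw, hF w hw, hall F _ _ w hw (hF w hw)⟩

omit [W.IsGloballyMinimal] in
/-- **(G) but not (G)-ordinary at `3` ⟺ (G) with `3 ∣ j`** (potentially good SUPERSINGULAR): for a
(G) pair, `¬ TypeGOrd W 3 ↔ (j = 0 ∨ ord₃ j > 0)` (`ord₃ j ≥ 0` is automatic for (G),
`padicValRat_j_nonneg_of_typeG`). -/
theorem not_typeGOrd_iff_of_typeG_three [W.IsGloballyMinimal] (hG : TypeG W 3) (hadd : Addv W 3) :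
    ¬ TypeGOrd W 3 ↔ (W.j = 0 ∨ 0 < padicValRat 3 W.j) := by
  haveI : Fact (Nat.Prime 3) := ⟨Nat.prime_three⟩
  have hnn : 0 ≤ padicValRat 3 W.j := padicValRat_j_nonneg_of_typeG W 3 hG
  rw [typeGOrd_three_iff_padicValRat_j W hadd]
  constructor
  · intro h
    by_cases hj0 : W.j = 0
    · exact Or.inl hj0
    · exact Or.inr (lt_of_le_of_ne hnn (fun h0 ↦ h ⟨hj0, h0.symm⟩))
  · rintro (h | h) ⟨hj0, hj⟩
    · exact hj0 h
    · exact absurd hj (ne_of_gt h)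

/-! ### Class level -/

variable [hp : Fact (Nat.Prime 3)]

/-- **X3♯(G-ord) at `p = 3` = X3 ∩ {`j` a `3`-adic unit}**: `ClassX3Gord W 3 ↔ ClassX3 W 3 ∧
j ≠ 0 ∧ ord₃ j = 0` — the sub-class is read off the tree's class X3 (`Red ∧ Addv`) and the
`j`-invariant, with no twist or field datum. -/
theorem classX3Gord_three_iff_j :
    ClassX3Gord W 3 ↔ ClassX3 W 3 ∧ W.j ≠ 0 ∧ padicValRat 3 W.j = 0 :=
  ⟨fun h ↦ ⟨h.classX3, padicValRat_j_eq_zero_of_typeGOrd_three W h.typeGOrd⟩,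
    fun ⟨hX, hj0, hj⟩ ↦ ⟨hX, typeGOrd_three_of_padicValRat_j_eq_zero W hX.2 hj0 hj⟩⟩

/-- **X4♯(G-ord) at `p = 3` = X4 ∩ {`j` a `3`-adic unit}**: `ClassX4Gord W 3 ↔ ClassX4 W 3 ∧
j ≠ 0 ∧ ord₃ j = 0`. -/
theorem classX4Gord_three_iff_j :
    ClassX4Gord W 3 ↔ ClassX4 W 3 ∧ W.j ≠ 0 ∧ padicValRat 3 W.j = 0 :=
  ⟨fun h ↦ ⟨h.classX4, padicValRat_j_eq_zero_of_typeGOrd_three W h.typeGOrd⟩,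
    fun ⟨hX, hj0, hj⟩ ↦ ⟨hX, typeGOrd_three_of_padicValRat_j_eq_zero W hX.2.1 hj0 hj⟩⟩

end Main

end Summit.BirchSwinnertonDyer.Rank1Residual.Additive

end
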